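import Mathlib
import HarnessLib
import Summits.HubbardSuperconductivity.HubbardSuperconductivity.Theorems.KLProgrammeKLRegimeEngineScaleZeroValuesExplicit

/-!
# Route `KLProgramme` — K3 VL child (stmt-HubbardSuperconductivity-23356), atom `stub_vl_HE1free`, LEVEL 0 («(VL)-HE1-LEVEL0», F4):
# the PLAIN DECAY CONSTANT of the cutoff-`Λ₁` covariance `S_NᵀC^K_{>Λ₁}S_N` on the `4M` time grid for admissible frames, uniform in `M`, `β`, `L`
# — the twin of k3c4-p2's `…EngineScaleZeroDecay` §2–§3 (+ p3 g6's column twin) ONE SCALE LOWER, `Λ = klE0 ↦ Λ₁ = klScale klE0 1 = e₀/4`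

Cell gate-hubbard-kl, seat p3 (g20); VL lead k3c4-p1 g18 (HE1-GRANULARITY-g18.md §2″).  The Literature row/column bound
`HubbardUVCovarianceCTDecayBound.rowSum/colSum_gridSub_hubbardCovAboveCT_le` is generic in the cutoff `Λ > 0`; k3c4-p2 instantiated it at `Λ = e₀`.
Here the same two lemmas are read at `Λ₁ = e₀/4 = 1/128` with the band geometry `UVLineBound μ K 7` of an admissible frame
(`uvLineBound_of_frameOK`, unchanged) and the uniform form is obtained at the time rate `s₀ = β·Λ₁/(2(2M))` by the SAME radicand algebra
(`radicand_scaleZero_eq`, generic in `Λ`; the edge term `β⁵Λ₁⁴/(4π²(2M−3)²) ≤ 1` from `β³ ≤ M`, `Λ₁⁴ = 2⁻²⁸`):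

* `rowSum_scaleOne_of_frameOK` / `colSum_scaleOne_of_frameOK` — explicit in `β, L, M, s₀, B₁, B₂`;
* **`alpha_scaleOne_le`** / **`alpha_scaleOne_col_le`** — `(β/(2(2M)))·Σ ‖(SᵀC^K_{>Λ₁}S) X Y‖ ≤ 14·√((1/2 + 12/Λ₁)(2/Λ₁ + 128π⁴K₂²/Λ₁ +
  2π⁵K₂²/Λ₁² + 1 + π⁴K_x²/Λ₁³))`, `K₂ = 4B₂ + 6B₁ + 2`, `K_x = 7²K₂·(2/Λ₁) + 7(2B₁+1)`, for `klBetaMin ≤ β`, `β³ ≤ M`;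
* **`rowSum_scaleOne_le_A1`** / **`colSum_scaleOne_le_A1`** — the same at the tree's profile bounds `B₁ = 32/3`, `B₂ = 1110` (`klsv_B₁`, `klsv_B₂`):
  `Σ ‖(SᵀC^K_{>Λ₁}S) X Y‖ ≤ (N/β)·A0₁` with `A0₁` the radicand constant written out (no new definition; `klScaleZeroA0` is the `e₀` value).

Input (I6) of the cutoff-`Λ₁` one-step `…EngineCutoffKernelNormsWtAt` (plain part of the weighted decay constant (α_w)₁).  Everything is proved;
no definitions, no named facts, no sorry.  [cite: BenfattoGiulianiMastropietro2006, Lemma 2.2 (2.52), §2.7 (2.81)]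
-/

noncomputable section

namespace Summit.HubbardSuperconductivity.HubbardSuperconductivity.Theorems.ScaleZeroDecay

set_option linter.dupNamespace false -- summit = problem name (single-conjunct summit), D-0017

open Real Finset Literature.MathematicalPhysics.QuantumLattice Literature.Probability.LatticeModels
open Literature.MathematicalPhysics.QuantumLattice.FermiRG
open Summit.HubbardSuperconductivity.HubbardSuperconductivity.Theorems.KLRegimeSplit
open Summit.HubbardSuperconductivity.HubbardSuperconductivity.Theorems.KLProgrammeLegKernels
open Summit.HubbardSuperconductivity.HubbardSuperconductivity.Theorems.DispersionFlow
open Summit.HubbardSuperconductivity.HubbardSuperconductivity.Theorems.EngineV8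

/-- `Λ₁ = klScale klE0 1 = 1/128 > 0`. -/
theorem klScale_klE0_one_pos : (0 : ℝ) < klScale klE0 1 := by norm_num [klE0, klScale]

/-! ## §2 The explicit row / column sums at `Λ₁` -/

section Grid

variable {R : RenConsts} {U : ℝ} {Nsc : ℕ} {μ : ℝ} {K : TrigPolyC4v} {β : ℝ} {B₁ B₂ : ℝ} {L M : ℕ} [NeZero L]

/-- **`hrow` for the scale-`0` covariance of an admissible frame** on the `2(2M)`-point grid at `Λ = klScale klE0 1`, explicit in `β, L, M`, the
time rate `s₀ > 0` and the cutoff-derivative bounds `B₁, B₂` (`D = 7` from `FrameOK`):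
`Σ_Y ‖(Sᵀ C^K_{>Λ₁} S) X Y‖ ≤ √((2+12/s₀)·14²)·√(2(2M)·L²·[ℓ²-terms])` (`Λ₁ = klScale klE0 1 = e₀/4`). -/
theorem rowSum_scaleOne_of_frameOK (hK : FrameOK R U Nsc μ K) (hβ : klBetaMin ≤ β)
    (hB₁ : ∀ x, |deriv salmhoferCutoff x| ≤ B₁) (hB₂ : ∀ x, |deriv (deriv salmhoferCutoff) x| ≤ B₂) (hM : 2 ≤ M)
    {s₀ : ℝ} (hs₀ : 0 < s₀) (X : GridLeg (GridPoint L (2 * (2 * M)))) :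
    ∑ Y : GridLeg (GridPoint L (2 * (2 * M))),
        ‖((hubbardGridSub L M β (2 * (2 * M))).transpose * hubbardCovAboveCT L M β μ 0 K (klScale klE0 1) *
            hubbardGridSub L M β (2 * (2 * M))) X Y‖ ≤
      Real.sqrt ((2 + 12 / s₀) * 14 ^ 2) *
        Real.sqrt ((((2 * (2 * M) : ℕ) : ℝ)) ^ 1 * (L : ℝ) ^ 2 *
          ((L : ℝ) ^ 2 * ((1 / (β * (L : ℝ) ^ 2)) ^ 2 * (2 * β / klScale klE0 1)) +
            ((((2 * (2 * M) : ℕ) : ℝ)) * s₀ / 4) ^ 4 *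
              ((L : ℝ) ^ 2 * ((1 / (β * (L : ℝ) ^ 2)) ^ 2 * (2 * Real.pi / β) ^ 4 * (4 * B₂ + 6 * B₁ + 2) ^ 2 *
                  (64 * ((2 / klScale klE0 1) ^ 4 * (2 * β / klScale klE0 1)) + (2 / klScale klE0 1) ^ 6 * (64 * Real.pi))) +
                4 * ((L : ℝ) ^ 2 * (4 * ((1 / (β * (L : ℝ) ^ 2)) ^ 2 * ((β * (L : ℝ) ^ 2) * (β / (Real.pi * (2 * M - 3)))))) ^ 2)) +
            2 * (((L : ℝ) / 4) ^ 4 *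
              ((L : ℝ) ^ 2 * ((1 / (β * (L : ℝ) ^ 2)) ^ 2 * (2 * Real.pi / L) ^ 4 *
                ((7 : ℝ) ^ 2 * (4 * B₂ + 6 * B₁ + 2) * (2 / klScale klE0 1) + 7 * (2 * B₁ + 1)) ^ 2 * ((2 / klScale klE0 1) ^ (2 * 1) * (2 * β / klScale klE0 1))))))) := by
  haveI : NeZero (2 * (2 * M)) := ⟨by omega⟩
  exact rowSum_gridSub_hubbardCovAboveCT_le (beta_pos_of_klBetaMin_le hβ) (by norm_num [klE0, klScale]) hB₁ hB₂ (by norm_num)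
    (uvLineBound_of_frameOK hK) hM (by omega) hs₀ X

/-- **`hcol` for the cutoff-`Λ₁` covariance of an admissible frame** (same bound for the column sums). -/
theorem colSum_scaleOne_of_frameOK (hK : FrameOK R U Nsc μ K) (hβ : klBetaMin ≤ β)
    (hB₁ : ∀ x, |deriv salmhoferCutoff x| ≤ B₁) (hB₂ : ∀ x, |deriv (deriv salmhoferCutoff) x| ≤ B₂) (hM : 2 ≤ M)
    {s₀ : ℝ} (hs₀ : 0 < s₀) (Y : GridLeg (GridPoint L (2 * (2 * M)))) :
    ∑ X : GridLeg (GridPoint L (2 * (2 * M))),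
        ‖((hubbardGridSub L M β (2 * (2 * M))).transpose * hubbardCovAboveCT L M β μ 0 K (klScale klE0 1) *
            hubbardGridSub L M β (2 * (2 * M))) X Y‖ ≤
      Real.sqrt ((2 + 12 / s₀) * 14 ^ 2) *
        Real.sqrt ((((2 * (2 * M) : ℕ) : ℝ)) ^ 1 * (L : ℝ) ^ 2 *
          ((L : ℝ) ^ 2 * ((1 / (β * (L : ℝ) ^ 2)) ^ 2 * (2 * β / klScale klE0 1)) +
            ((((2 * (2 * M) : ℕ) : ℝ)) * s₀ / 4) ^ 4 *
              ((L : ℝ) ^ 2 * ((1 / (β * (L : ℝ) ^ 2)) ^ 2 * (2 * Real.pi / β) ^ 4 * (4 * B₂ + 6 * B₁ + 2) ^ 2 *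
                  (64 * ((2 / klScale klE0 1) ^ 4 * (2 * β / klScale klE0 1)) + (2 / klScale klE0 1) ^ 6 * (64 * Real.pi))) +
                4 * ((L : ℝ) ^ 2 * (4 * ((1 / (β * (L : ℝ) ^ 2)) ^ 2 * ((β * (L : ℝ) ^ 2) * (β / (Real.pi * (2 * M - 3)))))) ^ 2)) +
            2 * (((L : ℝ) / 4) ^ 4 *
              ((L : ℝ) ^ 2 * ((1 / (β * (L : ℝ) ^ 2)) ^ 2 * (2 * Real.pi / L) ^ 4 *
                ((7 : ℝ) ^ 2 * (4 * B₂ + 6 * B₁ + 2) * (2 / klScale klE0 1) + 7 * (2 * B₁ + 1)) ^ 2 * ((2 / klScale klE0 1) ^ (2 * 1) * (2 * β / klScale klE0 1))))))) := by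
  haveI : NeZero (2 * (2 * M)) := ⟨by omega⟩
  exact colSum_gridSub_hubbardCovAboveCT_le (beta_pos_of_klBetaMin_le hβ) (by norm_num [klE0, klScale]) hB₁ hB₂ (by norm_num)
    (uvLineBound_of_frameOK hK) hM (by omega) hs₀ Y


end Grid

/-! ## §3 The `M`-, `β`-, `L`-uniform form at the time rate `s₀ = β·Λ₁/(2(2M))` -/

section Alpha

variable {R : RenConsts} {U : ℝ} {Nsc : ℕ} {μ : ℝ} {K : TrigPolyC4v} {β : ℝ} {B₁ B₂ : ℝ} {L M : ℕ} [NeZero L]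

/-- **The decay constant of the cutoff-`Λ₁` covariance is `O(1)` against the grid weight**: for an admissible frame, `klBetaMin ≤ β` and
`β³ ≤ M`, on the `2(2M)` grid,
`(β/(2(2M)))·Σ_Y ‖(Sᵀ C^K_{>Λ₁} S) X Y‖ ≤ 14·√((1/2 + 12/Λ₁)(2/Λ₁ + 128π⁴K₂²/Λ₁ + 2π⁵K₂²/Λ₁² + 1 + π⁴K_x²/Λ₁³))`,
`K₂ = 4B₂ + 6B₁ + 2`, `K_x = 7²K₂·(2/Λ₁) + 7(2B₁+1)`, `Λ₁ = klScale klE0 1 = 1/128` — uniform in `M`, `β`, `L`, `μ`, `U`, the frame (the product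
`α·(β/N)` is what the smallness `θ` of `sum_norm_kernel_effAction_le_of_gramBounded` reads, the grid vertex carrying the weight `β/N`). -/
theorem alpha_scaleOne_le (hK : FrameOK R U Nsc μ K) (hβ : klBetaMin ≤ β)
    (hB₁ : ∀ x, |deriv salmhoferCutoff x| ≤ B₁) (hB₂ : ∀ x, |deriv (deriv salmhoferCutoff) x| ≤ B₂) (hβM : β ^ 3 ≤ (M : ℝ))
    (X : GridLeg (GridPoint L (2 * (2 * M)))) :
    β / (((2 * (2 * M) : ℕ) : ℝ)) * ∑ Y : GridLeg (GridPoint L (2 * (2 * M))),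
        ‖((hubbardGridSub L M β (2 * (2 * M))).transpose * hubbardCovAboveCT L M β μ 0 K (klScale klE0 1) *
            hubbardGridSub L M β (2 * (2 * M))) X Y‖ ≤
      14 * Real.sqrt ((1 / 2 + 12 / klScale klE0 1) *
        (2 / klScale klE0 1 + 128 * Real.pi ^ 4 * (4 * B₂ + 6 * B₁ + 2) ^ 2 / klScale klE0 1 + 2 * Real.pi ^ 5 * (4 * B₂ + 6 * B₁ + 2) ^ 2 / klScale klE0 1 ^ 2 + 1 +
          Real.pi ^ 4 * ((7 : ℝ) ^ 2 * (4 * B₂ + 6 * B₁ + 2) * (2 / klScale klE0 1) + 7 * (2 * B₁ + 1)) ^ 2 / klScale klE0 1 ^ 3)) := by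
  have hβ0 : 0 < β := beta_pos_of_klBetaMin_le hβ
  have hβ128 : (128 : ℝ) ≤ β := by simpa [klBetaMin] using hβ
  have hΛ : (0 : ℝ) < klScale klE0 1 := by norm_num [klE0, klScale]
  have hL : (0 : ℝ) < L := by exact_mod_cast Nat.pos_of_ne_zero (NeZero.ne L)
  have hβ3 : β ≤ β ^ 3 := by nlinarith [sq_nonneg β]
  have hMr : β ≤ (M : ℝ) := hβ3.trans hβM
  have hM2 : 2 ≤ M := by
    have : (2 : ℝ) ≤ M := by linarith
    exact_mod_cast this
  have hM3 : (3 : ℝ) ≤ M := by linarith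
  have hN4 : (((2 * (2 * M) : ℕ) : ℝ)) = 4 * M := by push_cast; ring
  have hN0 : 0 < (((2 * (2 * M) : ℕ) : ℝ)) := by rw [hN4]; positivity
  have hs₀pos : 0 < β * klScale klE0 1 / (((2 * (2 * M) : ℕ) : ℝ)) := by positivity
  have hrow := rowSum_scaleOne_of_frameOK (L := L) hK hβ hB₁ hB₂ hM2 hs₀pos X
  refine mul_le_fourteen_sqrt_of_le hrow (by positivity) (by positivity) ?_
  rw [radicand_scaleZero_eq hN0.ne' hL.ne' hβ0.ne' hΛ.ne' (by linarith)]
  refine mul_le_mul_of_nonneg_left ?_ (by norm_num)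
  have hB10 : 0 ≤ B₁ := (abs_nonneg _).trans (hB₁ 0)
  have hB20 : 0 ≤ B₂ := (abs_nonneg _).trans (hB₂ 0)
  have h1 : 2 * β / (((2 * (2 * M) : ℕ) : ℝ)) + 12 / klScale klE0 1 ≤ 1 / 2 + 12 / klScale klE0 1 := by
    have : 2 * β / (((2 * (2 * M) : ℕ) : ℝ)) ≤ 1 / 2 := by rw [div_le_iff₀ hN0, hN4]; linarith
    linarith
  have hT3 : 256 * Real.pi ^ 5 * (4 * B₂ + 6 * B₁ + 2) ^ 2 / (β * klScale klE0 1 ^ 2) ≤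
      2 * Real.pi ^ 5 * (4 * B₂ + 6 * B₁ + 2) ^ 2 / klScale klE0 1 ^ 2 := by
    rw [div_le_div_iff₀ (by positivity) (by positivity)]
    have : 0 ≤ Real.pi ^ 5 * (4 * B₂ + 6 * B₁ + 2) ^ 2 * klScale klE0 1 ^ 2 := by positivity
    nlinarith
  have hT4 : β ^ 5 * klScale klE0 1 ^ 4 / (4 * Real.pi ^ 2 * (2 * M - 3) ^ 2) ≤ 1 := by
    have hM' : β ^ 3 ≤ 2 * (M : ℝ) - 3 := by linarith
    have h6 : (β ^ 3) ^ 2 ≤ (2 * (M : ℝ) - 3) ^ 2 := pow_le_pow_left₀ (by positivity) hM' 2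
    have hπ2 : 9 ≤ Real.pi ^ 2 := by nlinarith [Real.pi_gt_three]
    have hden : (0 : ℝ) < 4 * Real.pi ^ 2 * (2 * M - 3) ^ 2 := by
      have : (0 : ℝ) < 2 * M - 3 := by linarith
      positivity
    rw [div_le_one hden, show klScale klE0 1 ^ 4 = (1 : ℝ) / 2 ^ 28 by norm_num [klE0, klScale]]
    have hβ5 : β ^ 5 ≤ (β ^ 3) ^ 2 := by
      rw [← pow_mul, show 3 * 2 = 5 + 1 from rfl, pow_succ]
      exact le_mul_of_one_le_right (by positivity) (by linarith)
    nlinarith [pow_pos hβ0 5]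
  have hpos : 0 ≤ 2 / klScale klE0 1 + 128 * Real.pi ^ 4 * (4 * B₂ + 6 * B₁ + 2) ^ 2 / klScale klE0 1 +
      256 * Real.pi ^ 5 * (4 * B₂ + 6 * B₁ + 2) ^ 2 / (β * klScale klE0 1 ^ 2) + β ^ 5 * klScale klE0 1 ^ 4 / (4 * Real.pi ^ 2 * (2 * M - 3) ^ 2) +
      Real.pi ^ 4 * ((7 : ℝ) ^ 2 * (4 * B₂ + 6 * B₁ + 2) * (2 / klScale klE0 1) + 7 * (2 * B₁ + 1)) ^ 2 / klScale klE0 1 ^ 3 := by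
    have : (0 : ℝ) < 2 * M - 3 := by linarith
    positivity
  refine mul_le_mul h1 ?_ hpos (by positivity)
  linarith

/-- **Column sums**: `(β/(2(2M)))·Σ_X ‖(Sᵀ C^K_{>Λ₁} S) X Y‖ ≤ A₀(Λ₁; B₁, B₂)` — the proof of `alpha_scaleOne_le` read on
`colSum_scaleOne_of_frameOK` (same radicand). -/
theorem alpha_scaleOne_col_le (hK : FrameOK R U Nsc μ K) (hβ : klBetaMin ≤ β)
    (hB₁ : ∀ x, |deriv salmhoferCutoff x| ≤ B₁) (hB₂ : ∀ x, |deriv (deriv salmhoferCutoff) x| ≤ B₂) (hβM : β ^ 3 ≤ (M : ℝ))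
    (Y : GridLeg (GridPoint L (2 * (2 * M)))) :
    β / (((2 * (2 * M) : ℕ) : ℝ)) * ∑ X : GridLeg (GridPoint L (2 * (2 * M))),
        ‖((hubbardGridSub L M β (2 * (2 * M))).transpose * hubbardCovAboveCT L M β μ 0 K (klScale klE0 1) *
            hubbardGridSub L M β (2 * (2 * M))) X Y‖ ≤
      14 * Real.sqrt ((1 / 2 + 12 / klScale klE0 1) *
        (2 / klScale klE0 1 + 128 * Real.pi ^ 4 * (4 * B₂ + 6 * B₁ + 2) ^ 2 / klScale klE0 1 + 2 * Real.pi ^ 5 * (4 * B₂ + 6 * B₁ + 2) ^ 2 / klScale klE0 1 ^ 2 + 1 +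
          Real.pi ^ 4 * ((7 : ℝ) ^ 2 * (4 * B₂ + 6 * B₁ + 2) * (2 / klScale klE0 1) + 7 * (2 * B₁ + 1)) ^ 2 / klScale klE0 1 ^ 3)) := by
  have hβ0 : 0 < β := beta_pos_of_klBetaMin_le hβ
  have hβ128 : (128 : ℝ) ≤ β := by simpa [klBetaMin] using hβ
  have hΛ : (0 : ℝ) < klScale klE0 1 := by norm_num [klE0, klScale]
  have hL : (0 : ℝ) < L := by exact_mod_cast Nat.pos_of_ne_zero (NeZero.ne L)
  have hβ3 : β ≤ β ^ 3 := by nlinarith [sq_nonneg β]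
  have hMr : β ≤ (M : ℝ) := hβ3.trans hβM
  have hM2 : 2 ≤ M := by
    have : (2 : ℝ) ≤ M := by linarith
    exact_mod_cast this
  have hN4 : (((2 * (2 * M) : ℕ) : ℝ)) = 4 * M := by push_cast; ring
  have hN0 : 0 < (((2 * (2 * M) : ℕ) : ℝ)) := by rw [hN4]; positivity
  have hs₀pos : 0 < β * klScale klE0 1 / (((2 * (2 * M) : ℕ) : ℝ)) := by positivity
  have hcol := colSum_scaleOne_of_frameOK (L := L) hK hβ hB₁ hB₂ hM2 hs₀pos Y
  refine mul_le_fourteen_sqrt_of_le hcol (by positivity) (by positivity) ?_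
  rw [radicand_scaleZero_eq hN0.ne' hL.ne' hβ0.ne' hΛ.ne' (by linarith)]
  refine mul_le_mul_of_nonneg_left ?_ (by norm_num)
  have hB10 : 0 ≤ B₁ := (abs_nonneg _).trans (hB₁ 0)
  have hB20 : 0 ≤ B₂ := (abs_nonneg _).trans (hB₂ 0)
  have h1 : 2 * β / (((2 * (2 * M) : ℕ) : ℝ)) + 12 / klScale klE0 1 ≤ 1 / 2 + 12 / klScale klE0 1 := by
    have : 2 * β / (((2 * (2 * M) : ℕ) : ℝ)) ≤ 1 / 2 := by rw [div_le_iff₀ hN0, hN4]; linarith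
    linarith
  have hT3 : 256 * Real.pi ^ 5 * (4 * B₂ + 6 * B₁ + 2) ^ 2 / (β * klScale klE0 1 ^ 2) ≤
      2 * Real.pi ^ 5 * (4 * B₂ + 6 * B₁ + 2) ^ 2 / klScale klE0 1 ^ 2 := by
    rw [div_le_div_iff₀ (by positivity) (by positivity)]
    have : 0 ≤ Real.pi ^ 5 * (4 * B₂ + 6 * B₁ + 2) ^ 2 * klScale klE0 1 ^ 2 := by positivity
    nlinarith
  have hT4 : β ^ 5 * klScale klE0 1 ^ 4 / (4 * Real.pi ^ 2 * (2 * M - 3) ^ 2) ≤ 1 := by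
    have hM' : β ^ 3 ≤ 2 * (M : ℝ) - 3 := by linarith
    have h6 : (β ^ 3) ^ 2 ≤ (2 * (M : ℝ) - 3) ^ 2 := pow_le_pow_left₀ (by positivity) hM' 2
    have hπ2 : 9 ≤ Real.pi ^ 2 := by nlinarith [Real.pi_gt_three]
    have hden : (0 : ℝ) < 4 * Real.pi ^ 2 * (2 * M - 3) ^ 2 := by
      have : (0 : ℝ) < 2 * M - 3 := by linarith
      positivity
    rw [div_le_one hden, show klScale klE0 1 ^ 4 = (1 : ℝ) / 2 ^ 28 by norm_num [klE0, klScale]]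
    have hβ5 : β ^ 5 ≤ (β ^ 3) ^ 2 := by
      rw [← pow_mul, show 3 * 2 = 5 + 1 from rfl, pow_succ]
      exact le_mul_of_one_le_right (by positivity) (by linarith)
    nlinarith [pow_pos hβ0 5]
  have hpos : 0 ≤ 2 / klScale klE0 1 + 128 * Real.pi ^ 4 * (4 * B₂ + 6 * B₁ + 2) ^ 2 / klScale klE0 1 +
      256 * Real.pi ^ 5 * (4 * B₂ + 6 * B₁ + 2) ^ 2 / (β * klScale klE0 1 ^ 2) + β ^ 5 * klScale klE0 1 ^ 4 / (4 * Real.pi ^ 2 * (2 * M - 3) ^ 2) +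
      Real.pi ^ 4 * ((7 : ℝ) ^ 2 * (4 * B₂ + 6 * B₁ + 2) * (2 / klScale klE0 1) + 7 * (2 * B₁ + 1)) ^ 2 / klScale klE0 1 ^ 3 := by
    have : (0 : ℝ) < 2 * M - 3 := by linarith
    positivity
  refine mul_le_mul h1 ?_ hpos (by positivity)
  linarith

/-- **Row sums at the named constant**: `Σ_Y ‖(SᵀC₀S) X Y‖ ≤ (N/β)·A0₁` (`A0₁` = the radicand constant of `alpha_scaleOne_le` at `B₁ = 32/3`, `B₂ = 1110`, written out)`. -/
theorem rowSum_scaleOne_le_A1 [NeZero M] (hK : FrameOK R U Nsc μ K) (hβ : klBetaMin ≤ β) (hβM : β ^ 3 ≤ (M : ℝ))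
    (X : GridLeg (GridPoint L (2 * (2 * M)))) :
    ∑ Y : GridLeg (GridPoint L (2 * (2 * M))),
        ‖((hubbardGridSub L M β (2 * (2 * M))).transpose * hubbardCovAboveCT L M β μ 0 K (klScale klE0 1) *
            hubbardGridSub L M β (2 * (2 * M))) X Y‖ ≤ (((2 * (2 * M) : ℕ) : ℝ)) / β *
        (14 * Real.sqrt ((1 / 2 + 12 / klScale klE0 1) *
          (2 / klScale klE0 1 + 128 * Real.pi ^ 4 * (4 * (1110 : ℝ) + 6 * (32 / 3) + 2) ^ 2 / klScale klE0 1 +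
            2 * Real.pi ^ 5 * (4 * (1110 : ℝ) + 6 * (32 / 3) + 2) ^ 2 / klScale klE0 1 ^ 2 + 1 +
            Real.pi ^ 4 * ((7 : ℝ) ^ 2 * (4 * (1110 : ℝ) + 6 * (32 / 3) + 2) * (2 / klScale klE0 1) + 7 * (2 * (32 / 3) + 1)) ^ 2 /
              klScale klE0 1 ^ 3))) := by
  have hβ0 : 0 < β := beta_pos_of_klBetaMin_le hβ
  have hN0 : 0 < (((2 * (2 * M) : ℕ) : ℝ)) := by have := NeZero.ne M; positivity
  have h := alpha_scaleOne_le (L := L) hK hβ klsv_B₁ klsv_B₂ hβM X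
  rw [div_mul_eq_mul_div, div_le_iff₀ hN0] at h
  rw [div_mul_eq_mul_div, le_div_iff₀ hβ0]
  linarith

/-- **Column sums at the named constant**: `Σ_X ‖(SᵀC₀S) X Y‖ ≤ (N/β)·A0₁` (`A0₁` = the radicand constant of `alpha_scaleOne_le` at `B₁ = 32/3`, `B₂ = 1110`, written out)`. -/
theorem colSum_scaleOne_le_A1 [NeZero M] (hK : FrameOK R U Nsc μ K) (hβ : klBetaMin ≤ β) (hβM : β ^ 3 ≤ (M : ℝ))
    (Y : GridLeg (GridPoint L (2 * (2 * M)))) :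
    ∑ X : GridLeg (GridPoint L (2 * (2 * M))),
        ‖((hubbardGridSub L M β (2 * (2 * M))).transpose * hubbardCovAboveCT L M β μ 0 K (klScale klE0 1) *
            hubbardGridSub L M β (2 * (2 * M))) X Y‖ ≤ (((2 * (2 * M) : ℕ) : ℝ)) / β *
        (14 * Real.sqrt ((1 / 2 + 12 / klScale klE0 1) *
          (2 / klScale klE0 1 + 128 * Real.pi ^ 4 * (4 * (1110 : ℝ) + 6 * (32 / 3) + 2) ^ 2 / klScale klE0 1 +
            2 * Real.pi ^ 5 * (4 * (1110 : ℝ) + 6 * (32 / 3) + 2) ^ 2 / klScale klE0 1 ^ 2 + 1 +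
            Real.pi ^ 4 * ((7 : ℝ) ^ 2 * (4 * (1110 : ℝ) + 6 * (32 / 3) + 2) * (2 / klScale klE0 1) + 7 * (2 * (32 / 3) + 1)) ^ 2 /
              klScale klE0 1 ^ 3))) := by
  have hβ0 : 0 < β := beta_pos_of_klBetaMin_le hβ
  have hN0 : 0 < (((2 * (2 * M) : ℕ) : ℝ)) := by have := NeZero.ne M; positivity
  have h := alpha_scaleOne_col_le (L := L) hK hβ klsv_B₁ klsv_B₂ hβM Y
  rw [div_mul_eq_mul_div, div_le_iff₀ hN0] at h
  rw [div_mul_eq_mul_div, le_div_iff₀ hβ0]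
  linarith

end Alpha

end Summit.HubbardSuperconductivity.HubbardSuperconductivity.Theorems.ScaleZeroDecay

end
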